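import Summits.ValiantsHypothesis.ValiantsHypothesis.Theorems.DepthWindowBoundedLettersLog

/-!
# Route `DepthWindow` — low-bias trees are stable under `ℓ¹`-small perturbations; CLUSTERED alphabets

Cone-free theorem (decomp-valiant lens 4, g15) supporting the crux item `HomImmHardTwoOne`
(stmt-ValiantsHypothesis-30635).  The tree built for a word `w̄` serves every word `w` with `Σ|wᵢ − w̄ᵢ| ≤ δ` at
the cost of `δ` more node bias (`LowBiasTree.perturb`: a node's children are disjoint blocks, so their sums move
by at most `δ` in total).  Hence the bounded-alphabet theorem (`lowBiasTree_of_card_image_le_clog`) extends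
from words with few VALUES to words with few CLUSTERS of values:

* `lowBiasTree_of_clusters` — if `rep : Fin d → ℤ` takes at most `n + 1` values, `|rep i| ≤ h`,
  `Σ |wᵢ − rep i| ≤ h` and `|Σ w| ≤ h`, then `w` has a tree of node bias `≤ 13h` at every depth
  `Δ ≥ 2·⌊log₂⌊log₂ 2h⌋⌋ + 8 + ⌈log₂(n+1)⌉`;
* `not_clusteredLetters_treeBiasGrowthAt` — door corollary: no family whose letter values lie in a bounded
  number of clusters of total width-mass `≤ 2·log₂ m` (e.g. `k + 1` clusters of width `≤ 2·log₂ m / √(log₂ m)`)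
  witnesses `TreeBiasGrowthAt a`, `a ≥ 2` (instance `c := 11 + ⌈log₂(k+1)⌉`, `C := 13`).

In the IMM regime (`d = ⌊√log₂ m⌋`, `h = 2 log₂ m ≈ 2d²`) letter values therefore only matter up to `± h/d ≈ 2d`.

References: [LimayeSrinivasanTavenas2022] CCC 2022 (LIPIcs 234:32) Def. 2, Question 1; full version ECCC
TR22-090 Def. 15, Prop. 16–17; [BhargavDuttaSaxena2024] ACM ToCT 16(4):23 Thm. 1.4.
-/

-- layout Summits/ValiantsHypothesis/ValiantsHypothesis forces the duplicated namespace component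
set_option linter.dupNamespace false

namespace Summit.ValiantsHypothesis.ValiantsHypothesis.Theorems.DepthWindow.TreeBias

open Finset Literature.Computability.AlgebraicComplexity

variable {d : ℕ}

/-! ### Perturbation stability -/

/-- Block sums move by at most the block's share of the perturbation. [folklore] -/
theorem abs_blockSum_sub_le (w w' : Fin d → ℤ) (T : LTree d) (t : ℕ) (l : Fin d) :
    |blockSum w' T t l - blockSum w T t l| ≤ ∑ j ∈ univ.filter (fun j => T.lab t j = l), |w' j - w j| := by
  unfold blockSum
  rw [← sum_sub_distrib]
  exact abs_sum_le_sum_abs _ _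

/-- Node biases move by at most the TOTAL perturbation `Σ |w'ᵢ − wᵢ|` (the children of a node are disjoint
blocks). [cite: LimayeSrinivasanTavenas2022, Def. 15] -/
theorem nodeBias_perturb_le (w w' : Fin d → ℤ) (T : LTree d) (u : ℕ) (i : Fin d) :
    nodeBias w' T u i ≤ nodeBias w T u i + ∑ j, |w' j - w j| := by
  classical
  unfold nodeBias
  set L := (univ.filter fun j => T.lab u j = T.lab u i).image (T.lab (u - 1)) with hL
  calc ∑ l ∈ L, |blockSum w' T (u - 1) l|
      ≤ ∑ l ∈ L, (|blockSum w T (u - 1) l| + ∑ j ∈ univ.filter (fun j => T.lab (u - 1) j = l), |w' j - w j|) :=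
        sum_le_sum fun l _ => by
          have := abs_blockSum_sub_le w w' T (u - 1) l
          have := abs_sub_abs_le_abs_sub (blockSum w' T (u - 1) l) (blockSum w T (u - 1) l)
          linarith
    _ = ∑ l ∈ L, |blockSum w T (u - 1) l| +
          ∑ l ∈ L, ∑ j ∈ univ.filter (fun j => T.lab (u - 1) j = l), |w' j - w j| := sum_add_distrib
    _ ≤ ∑ l ∈ L, |blockSum w T (u - 1) l| + ∑ j, |w' j - w j| := by
        refine add_le_add le_rfl ?_
        have e : ∑ l ∈ L, ∑ j ∈ univ.filter (fun j => T.lab (u - 1) j = l), |w' j - w j| =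
            ∑ j ∈ univ.filter (fun j => T.lab (u - 1) j ∈ L), |w' j - w j| := by
          rw [← sum_fiberwise_of_maps_to (s := univ.filter fun j => T.lab (u - 1) j ∈ L) (t := L)
            (g := T.lab (u - 1)) (fun j hj => (mem_filter.1 hj).2) (fun j => |w' j - w j|)]
          refine sum_congr rfl fun l hl => sum_congr ?_ fun _ _ => rfl
          ext j
          simp only [mem_filter, mem_univ, true_and]
          exact ⟨fun hj => ⟨by rw [hj]; exact hl, hj⟩, fun hj => hj.2⟩
        rw [e]
        exact sum_le_sum_of_subset_of_nonneg (filter_subset _ _) fun j _ _ => abs_nonneg _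

/-- **Perturbation stability.**  A tree for `w` with node biases `≤ β` is a tree for `w'` with node biases
`≤ β + Σ |w'ᵢ − wᵢ|`. [cite: LimayeSrinivasanTavenas2022, Prop. 16] -/
theorem LowBiasTree.perturb {w : Fin d → ℤ} {Δ : ℕ} {β : ℤ} (hT : LowBiasTree w Δ β) (w' : Fin d → ℤ)
    {δ : ℤ} (hδ : ∑ j, |w' j - w j| ≤ δ) : LowBiasTree w' Δ (β + δ) := by
  obtain ⟨T, hroot, hnb⟩ := hT
  exact ⟨T, hroot, fun u hu1 hu i => (nodeBias_perturb_le w w' T u i).trans (add_le_add (hnb u hu1 hu i) hδ)⟩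

/-! ### Clustered alphabets -/

/-- **`ULB₂` for clustered alphabets.**  If the letters of `w` are `h`-close in `ℓ¹` to a word `rep` with at most
`n + 1` values in `[-h, h]`, and `|Σ w| ≤ h`, then `w` has a tree of node bias `≤ 13h` at every depth
`Δ ≥ 2·⌊log₂⌊log₂ 2h⌋⌋ + 8 + ⌈log₂(n+1)⌉` (the pooled tree of `rep`, budget `2h`, perturbed).
[cite: LimayeSrinivasanTavenas2022, Question 1] -/
theorem lowBiasTree_of_clusters (h n : ℕ) (w rep : Fin d → ℤ) (hk : (univ.image rep).card ≤ n + 1)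
    (hrep : ∀ i, |rep i| ≤ h) (hclose : ∑ i, |w i - rep i| ≤ h) (hsum : |∑ i, w i| ≤ h) {Δ : ℕ}
    (hΔ : 2 * Nat.log 2 (Nat.log 2 (2 * h)) + 8 + Nat.clog 2 (n + 1) ≤ Δ) :
    LowBiasTree w Δ ((13 * h : ℕ) : ℤ) := by
  have hrep' : ∀ i, |rep i| ≤ ((2 * h : ℕ) : ℤ) := fun i => (hrep i).trans (by push_cast; linarith)
  have hrsum : |∑ i, rep i| ≤ ((2 * h : ℕ) : ℤ) := by
    have e : ∑ i, rep i = ∑ i, w i - ∑ i, (w i - rep i) := by rw [sum_sub_distrib]; ring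
    rw [e]
    have := abs_sub (∑ i, w i) (∑ i, (w i - rep i))
    have := abs_sum_le_sum_abs (fun i => w i - rep i) univ
    push_cast; linarith
  have hT := lowBiasTree_of_card_image_le_clog (2 * h) n rep hk hrep' hrsum (Or.inl hΔ)
  convert hT.perturb w hclose using 2
  push_cast
  ring

/-- **Clustered alphabets cannot witness `TreeBiasGrowthAt a`, `a ≥ 2`.**  The negated statement is
`TreeBiasGrowthAt a` with the conjunct «the word is `2·log₂ m`-close in `ℓ¹` to a word with at most `k + 1`
values in `[-2 log₂ m, 2 log₂ m]`» added; instance `c := 11 + ⌈log₂(k+1)⌉`, `C := 13`.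
[cite: BhargavDuttaSaxena2024, Thm. 1.4] -/
theorem not_clusteredLetters_treeBiasGrowthAt {a : ℕ} (ha : 2 ≤ a) (k : ℕ) :
    ¬ (∀ C : ℕ, ∃ m₀ : ℕ, ∀ m : ℕ, m₀ ≤ m →
        ∀ Δ : ℕ, Δ ≤ a * Nat.log 2 (Nat.log 2 (Nat.log 2 m)) + (11 + Nat.clog 2 (k + 1)) + 1 →
          ∃ (sz : Fin (Nat.sqrt (Nat.log 2 m)) → ℕ) (pos : Fin (Nat.sqrt (Nat.log 2 m)) → Bool)
            (rep : Fin (Nat.sqrt (Nat.log 2 m)) → ℤ),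
            (∀ i, 1 ≤ sz i) ∧ (∀ t ≤ Nat.sqrt (Nat.log 2 m), 2 ^ GenWord.overLen sz pos t ≤ m) ∧
            (univ.image rep).card ≤ k + 1 ∧ (∀ i, |rep i| ≤ ((2 * Nat.log 2 m : ℕ) : ℤ)) ∧
            ∑ i, |GenWord.wt sz pos i - rep i| ≤ ((2 * Nat.log 2 m : ℕ) : ℤ) ∧
            TreeBiasGe (GenWord.wt sz pos) Δ
              (2 * (C * (a * Nat.log 2 (Nat.log 2 (Nat.log 2 m)) + (11 + Nat.clog 2 (k + 1)) + 2) *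
                Nat.log 2 m))) := by
  intro hG
  obtain ⟨m₀, hm₀⟩ := hG 13
  obtain ⟨m, hmm₀, hm2⟩ : ∃ m, m₀ ≤ m ∧ 2 ≤ m := ⟨max m₀ 2, le_max_left _ _, le_max_right _ _⟩
  have hL : 1 ≤ Nat.log 2 m := Nat.le_log_of_pow_le one_lt_two (by simpa using hm2)
  obtain ⟨sz, pos, rep, _hsz, hfit, hk, hrep, hclose, hTB⟩ := hm₀ m hmm₀ _ le_rfl
  have hws : |∑ i, GenWord.wt sz pos i| ≤ ((2 * Nat.log 2 m : ℕ) : ℤ) :=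
    le_trans (abs_sum_wt_le sz pos hfit) (by push_cast; linarith)
  -- depth bookkeeping: 2·log₂log₂(4L) + 8 + κ ≤ 2X + 12 + κ ≤ aX + (11 + κ) + 1
  have hdepth : 2 * Nat.log 2 (Nat.log 2 (2 * (2 * Nat.log 2 m))) + 8 + Nat.clog 2 (k + 1) ≤
      a * Nat.log 2 (Nat.log 2 (Nat.log 2 m)) + (11 + Nat.clog 2 (k + 1)) + 1 := by
    have h1 : Nat.log 2 (2 * (2 * Nat.log 2 m)) = Nat.log 2 (Nat.log 2 m) + 2 := by
      rw [Nat.mul_comm 2 (2 * Nat.log 2 m), Nat.log_mul_base one_lt_two (by omega), Nat.mul_comm,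
        Nat.log_mul_base one_lt_two (by omega)]
    have h2 : Nat.log 2 (Nat.log 2 (Nat.log 2 m) + 2) ≤ Nat.log 2 (Nat.log 2 (Nat.log 2 m)) + 2 := by
      have step : ∀ y : ℕ, Nat.log 2 (y + 1) ≤ Nat.log 2 y + 1 := fun y =>
        (le_trans (Nat.log_mono_right (Nat.lt_pow_succ_log_self one_lt_two _)) (Nat.log_pow one_lt_two _).le)
      exact (step _).trans (by have := step (Nat.log 2 (Nat.log 2 m)); omega)
    have h3 : 2 * Nat.log 2 (Nat.log 2 (Nat.log 2 m)) ≤ a * Nat.log 2 (Nat.log 2 (Nat.log 2 m)) :=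
      Nat.mul_le_mul_right _ ha
    rw [h1]; omega
  have hT := lowBiasTree_of_clusters (2 * Nat.log 2 m) k (GenWord.wt sz pos) rep hk hrep hclose hws hdepth
  refine not_treeBiasGe_of_lowBiasTree hT ?_ hTB
  have hnat : (a * Nat.log 2 (Nat.log 2 (Nat.log 2 m)) + (11 + Nat.clog 2 (k + 1)) + 1) *
      (13 * (2 * Nat.log 2 m)) < 2 * (13 * (a * Nat.log 2 (Nat.log 2 (Nat.log 2 m)) +
        (11 + Nat.clog 2 (k + 1)) + 2) * Nat.log 2 m) := by
    have : (a * Nat.log 2 (Nat.log 2 (Nat.log 2 m)) + (11 + Nat.clog 2 (k + 1)) + 1) *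
        (13 * (2 * Nat.log 2 m)) + 26 * Nat.log 2 m = 2 * (13 * (a * Nat.log 2 (Nat.log 2 (Nat.log 2 m)) +
        (11 + Nat.clog 2 (k + 1)) + 2) * Nat.log 2 m) := by
      ring
    omega
  exact_mod_cast hnat

end Summit.ValiantsHypothesis.ValiantsHypothesis.Theorems.DepthWindow.TreeBias
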